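import Summits.CriticalPhenomena.PercolationContinuityZ3.Theorems.Transplant.HexShadowRouteData
import HarnessLib

/-!
# HEXAGONAL SHADOWS XLVII — routing data over cleared VERTEX sets, swap pairs, and the instance node `ShapedLinkage`

builds on p205010 (kernel theorem, internal audit signed; external expert review pending) — NOT used in this file.  Lane `prim-bschramm`, seat
`prim-bschramm-p2` (gen 34; class C1b; memo `HOME/bschramm/P2-LATTICES.md` §125); helper file (`--supports stmt-CriticalPhenomena-4575 --as helper`).

WHY.  The node `HexShadow.LocalLinkage` of «HexShadowRouteData» asks the instance for swap pairs of routings through the FULL lifted blocks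
`\overline{blk z t s}` and for ALL terminal triples.  For the `(111)`-films `F_k` this is false (gen 33, memo §124): the lifted clipped hexagons have
vertices of block-degree `1` (extreme levels over the hexagon's corners, the acute corners of the half-hexagons), and a first visit `E₁` of `γ_min` at such a
vertex whose only block-neighbour is the exit `w'` of the `(P2)`-witness admits no rerouting at all.  The repair, in the form the vertex-set surgery
«HexShadowVSurgeryData» consumes:
* §1 `VRouteData G WR W E₁ E₂ w'` — «HexShadowRouteData»'s routing data with the column sets `RP ⊆ D` replaced by VERTEX sets `WR ⊆ W` (rerouted piece
  inside `WR`, branch inside `W`), its consequences, monotonicity and transport along graph isomorphisms;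
* §2 the instance node **`HexShadow.ShapedLinkage Φ R`** (surgery radius `R`; the routing consumes `R = 3`): for every clipped block pair the instance CHOOSES the cleared vertex set `W` (anything between the
  lift of `hexBall z 1 ∩ blkR R z t_D s_D` and the lift of `blkR R z t_D s_D` — it drops the degenerate vertices), and supplies a swap pair for every terminal
  triple satisfying the constraints the generic side can certify (`HexShadow.Terminals`: `E₁ ≠ E₂` in `W` over the rerouting block, `w' ∈ W` off the
  columns of `z, E₁, E₂`, and the four `γ_min`-neighbours `o₁ → E₁ → a₁ ⋯ a₂ → E₂ → o₂` — `o₁, o₂` outside `W` inside the window, all distinct as vertices of a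
  self-avoiding path through a vertex over `z`, their columns distinct from that of `w'`);
* §3 `VRouteData.exists_key` / `exists_W_of_shapedLinkage`: the keyed routing (DST's order condition for the tree's enumeration `vtxKey`).
[cite: DuminilCopinSidoraviciusTassion2016, §2.3 (proof of Fact 2, pp. 6–7: the radius R, γ_u, γ_v, γ_w, "(z,v) ≺ (z,w)")] [cite: NewmanTassionWu2017, §3.2 (proof of Thm. 3.9)]
-/

noncomputable section

namespace Summit.CriticalPhenomena.PercolationContinuityZ3.Theorems.Transplant

open MeasureTheory Literature.Probability.Percolation Literature.Probability.LatticeModels SimpleGraph Filter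
open scoped Classical Topology

/-! ## §1 Routing data over vertex sets -/

/-- **Routing data of one local surgery over cleared VERTEX sets** `WR ⊆ W` (DST's three disjoint paths, in the form `HexShadow.VSurgery` consumes): the
rerouted piece `P` — `E₁ :: P ++ [E₂]` a self-avoiding `G`-chain with interior in `WR` —, the attachment vertex `c` with its successor `y`, and the branch
`Br ≠ []` — a self-avoiding `G`-chain `c :: Br` ending at `w'`, inside `W`, off the rerouted chain.
[cite: DuminilCopinSidoraviciusTassion2016, §2.3, proof of Fact 2 (γ_u, γ_v, γ_w)] -/
structure VRouteData {V : Type} (G : SimpleGraph V) (WR W : Set V) (E₁ E₂ w' : V) where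
  /-- the rerouted piece, strictly between `E₁` and `E₂` -/
  P : List V
  /-- the attachment vertex -/
  c : V
  /-- the successor of `c` on `E₁ :: P ++ [E₂]` -/
  y : V
  /-- the branch, from a neighbour of `c` to `w'` -/
  Br : List V
  hP : ∀ x ∈ P, x ∈ WR
  hchain : (E₁ :: (P ++ [E₂])).IsChain (fun a b => G.Adj a b)
  hnodup : (E₁ :: (P ++ [E₂])).Nodup
  hy : ∃ l₁ l₂ : List V, E₁ :: (P ++ [E₂]) = l₁ ++ c :: y :: l₂
  hBr : Br ≠ []
  hBrW : ∀ x ∈ Br, x ∈ W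
  hBrchain : (c :: Br).IsChain (fun a b => G.Adj a b)
  hBrnodup : (c :: Br).Nodup
  hBrSP : ∀ x ∈ Br, x ∉ E₁ :: (P ++ [E₂])
  hBrlast : Br.getLast hBr = w'

namespace VRouteData

variable {V : Type} {G : SimpleGraph V} {WR W : Set V} {E₁ E₂ w' : V}

/-- The first branch vertex `b = Br.head`. [cite: DuminilCopinSidoraviciusTassion2016, §2.3, proof of Fact 2 (the vertex w)] -/
def b (r : VRouteData G WR W E₁ E₂ w') : V := r.Br.head r.hBr

/-- **The order condition follows from the key comparison of `y` and `b`.** [folklore] -/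
theorem hfwd_of_key [Countable V] (r : VRouteData G WR W E₁ E₂ w') (hkey : vtxKey V r.y < vtxKey V r.b) :
    ∀ (l₁ l₂ : List V) (y' : V), E₁ :: (r.P ++ [E₂]) = l₁ ++ r.c :: y' :: l₂ → vtxKey V y' < vtxKey V (r.Br.head r.hBr) := by
  intro l₁ l₂ y' h
  obtain ⟨m₁, m₂, hm⟩ := r.hy
  rw [← HexShadow.RouteData.succ_unique r.hnodup hm h]
  exact hkey

/-- `c` lies on `E₁ :: P` (it has a successor on the chain). [folklore] -/
theorem c_mem (r : VRouteData G WR W E₁ E₂ w') : r.c ∈ E₁ :: r.P := by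
  obtain ⟨l₁, l₂, h⟩ := r.hy
  have hcSP : r.c ∈ E₁ :: (r.P ++ [E₂]) := by rw [h]; simp
  have hne : r.c ≠ E₂ := by
    have := HexShadow.RouteData.ne_getLast_of_succ h r.hnodup (List.cons_ne_nil _ _)
    simpa using this
  simp only [List.mem_cons, List.mem_append, List.not_mem_nil, or_false] at hcSP ⊢
  rcases hcSP with h1 | h1 | h1
  · exact Or.inl h1
  · exact Or.inr h1
  · exact absurd h1 hne

/-- `y` lies on the rerouted chain. [folklore] -/
theorem y_mem_SP (r : VRouteData G WR W E₁ E₂ w') : r.y ∈ E₁ :: (r.P ++ [E₂]) := by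
  obtain ⟨l₁, l₂, h⟩ := r.hy; rw [h]; simp

/-- `b` lies on the branch. [folklore] -/
theorem b_mem_Br (r : VRouteData G WR W E₁ E₂ w') : r.b ∈ r.Br := List.head_mem _

/-- `c` and `y` are adjacent. [folklore] -/
theorem adj_c_y (r : VRouteData G WR W E₁ E₂ w') : G.Adj r.c r.y := by
  obtain ⟨l₁, l₂, h⟩ := r.hy
  have hch := r.hchain
  rw [h, List.isChain_append] at hch
  exact (List.isChain_cons_cons.1 hch.2.1).1

/-- `c` and `b` are adjacent. [folklore] -/
theorem adj_c_b (r : VRouteData G WR W E₁ E₂ w') : G.Adj r.c r.b := by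
  have hch := r.hBrchain
  obtain ⟨x, xs, hx⟩ := List.exists_cons_of_ne_nil r.hBr
  have hb : r.b = x := by simp [b, hx]
  rw [hx] at hch
  rw [hb]
  exact (List.isChain_cons_cons.1 hch).1

/-- `y ≠ b` (the branch is off the rerouted chain). [folklore] -/
theorem y_ne_b (r : VRouteData G WR W E₁ E₂ w') : r.y ≠ r.b := fun h => r.hBrSP _ r.b_mem_Br (h ▸ r.y_mem_SP)

/-- **Monotonicity**: routing data for `WR ⊆ WR'`, `W ⊆ W'`. [folklore] -/
def mono (r : VRouteData G WR W E₁ E₂ w') {WR' W' : Set V} (hR : WR ⊆ WR') (hW : W ⊆ W') : VRouteData G WR' W' E₁ E₂ w' where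
  P := r.P
  c := r.c
  y := r.y
  Br := r.Br
  hP := fun x hx => hR (r.hP x hx)
  hchain := r.hchain
  hnodup := r.hnodup
  hy := r.hy
  hBr := r.hBr
  hBrW := fun x hx => hW (r.hBrW x hx)
  hBrchain := r.hBrchain
  hBrnodup := r.hBrnodup
  hBrSP := r.hBrSP
  hBrlast := r.hBrlast

/-- `mono` keeps `y`. [folklore] -/
@[simp] theorem mono_y (r : VRouteData G WR W E₁ E₂ w') {WR' W' : Set V} (hR : WR ⊆ WR') (hW : W ⊆ W') : (r.mono hR hW).y = r.y := rfl

/-- `mono` keeps `b`. [folklore] -/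
@[simp] theorem mono_b (r : VRouteData G WR W E₁ E₂ w') {WR' W' : Set V} (hR : WR ⊆ WR') (hW : W ⊆ W') : (r.mono hR hW).b = r.b := rfl

/-- **Transport along a graph isomorphism** mapping `WR` into `WR'` and `W` into `W'`: routing data for `(E₁, E₂, w')` maps to routing data for
`(α E₁, α E₂, α w')`. [folklore] -/
def map (r : VRouteData G WR W E₁ E₂ w') {V' : Type} {G' : SimpleGraph V'} (α : G ≃g G') {WR' W' : Set V'} (hR : ∀ v ∈ WR, α v ∈ WR')
    (hW : ∀ v ∈ W, α v ∈ W') : VRouteData G' WR' W' (α E₁) (α E₂) (α w') where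
  P := r.P.map α
  c := α r.c
  y := α r.y
  Br := r.Br.map α
  hP := by
    intro x hx
    obtain ⟨v, hv, rfl⟩ := List.mem_map.1 hx
    exact hR _ (r.hP v hv)
  hchain := by
    have : α E₁ :: (r.P.map α ++ [α E₂]) = (E₁ :: (r.P ++ [E₂])).map α := by simp
    rw [this, List.isChain_map]
    exact r.hchain.imp fun a b h => α.map_adj_iff.2 h
  hnodup := by
    have : α E₁ :: (r.P.map α ++ [α E₂]) = (E₁ :: (r.P ++ [E₂])).map α := by simp
    rw [this]
    exact r.hnodup.map α.injective
  hy := by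
    obtain ⟨l₁, l₂, h⟩ := r.hy
    refine ⟨l₁.map α, l₂.map α, ?_⟩
    have : α E₁ :: (r.P.map α ++ [α E₂]) = (E₁ :: (r.P ++ [E₂])).map α := by simp
    rw [this, h]; simp
  hBr := by simpa using r.hBr
  hBrW := by
    intro x hx
    obtain ⟨v, hv, rfl⟩ := List.mem_map.1 hx
    exact hW _ (r.hBrW v hv)
  hBrchain := by
    have : α r.c :: r.Br.map α = (r.c :: r.Br).map α := by simp
    rw [this, List.isChain_map]
    exact r.hBrchain.imp fun a b h => α.map_adj_iff.2 h
  hBrnodup := by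
    have : α r.c :: r.Br.map α = (r.c :: r.Br).map α := by simp
    rw [this]
    exact r.hBrnodup.map α.injective
  hBrSP := by
    intro x hx hmem
    obtain ⟨v, hv, rfl⟩ := List.mem_map.1 hx
    have : α E₁ :: (r.P.map α ++ [α E₂]) = (E₁ :: (r.P ++ [E₂])).map α := by simp
    rw [this, List.mem_map] at hmem
    obtain ⟨u, hu, huv⟩ := hmem
    rw [α.injective huv] at hu
    exact r.hBrSP v hv hu
  hBrlast := by rw [List.getLast_map, r.hBrlast]

/-- `map` acts on `y` by `α`. [folklore] -/
@[simp] theorem map_y (r : VRouteData G WR W E₁ E₂ w') {V' : Type} {G' : SimpleGraph V'} (α : G ≃g G') {WR' W' : Set V'}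
    (hR : ∀ v ∈ WR, α v ∈ WR') (hW : ∀ v ∈ W, α v ∈ W') : (r.map α hR hW).y = α r.y := rfl

/-- `map` acts on `b` by `α`. [folklore] -/
@[simp] theorem map_b (r : VRouteData G WR W E₁ E₂ w') {V' : Type} {G' : SimpleGraph V'} (α : G ≃g G') {WR' W' : Set V'}
    (hR : ∀ v ∈ WR, α v ∈ WR') (hW : ∀ v ∈ W, α v ∈ W') : (r.map α hR hW).b = α r.b := by
  simp only [b, map]
  obtain ⟨x, xs, hx⟩ := List.exists_cons_of_ne_nil r.hBr
  simp [hx]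

/-- **From a swap pair, a routing satisfying DST's order condition for the tree's enumeration.** [cite: DuminilCopinSidoraviciusTassion2016, §2.3, proof of Fact 2 ("(z,v) ≺ (z,w)")] -/
theorem exists_key [Countable V] (r₁ r₂ : VRouteData G WR W E₁ E₂ w') (h1 : r₁.y = r₂.b)
    (h2 : r₁.b = r₂.y) : ∃ r : VRouteData G WR W E₁ E₂ w', vtxKey V r.y < vtxKey V r.b := by
  rcases lt_or_ge (vtxKey V r₁.y) (vtxKey V r₁.b) with h | h
  · exact ⟨r₁, h⟩
  · refine ⟨r₂, lt_of_le_of_ne (by rw [← h1, ← h2]; exact h) fun heq => ?_⟩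
    exact r₂.y_ne_b (vtxKey_injective V heq)

end VRouteData

/-! ## §2 The terminals the generic side certifies, and the instance node -/

/-- **The clipped block of radius `R`**: `hexBall z R ∩ {w₀ ≤ z₀ + t} ∩ {w₀ + w₁ ≤ z₀ + z₁ + s}` (`t, s ≥ R`: no clipping in that direction); for `R = 3`
this is «HexShadowRouteData»'s `blk z t s` (`blkR_three`).  The radius is a parameter of the node so that an instance may ask for larger surgery blocks.
[cite: DuminilCopinSidoraviciusTassion2016, §2.3, proof of Fact 2 (the ball B_R(z))] -/
def blkR (R : ℕ) (z : Site 2) (t s : ℕ) : Set (Site 2) := {w | w ∈ hexBall z R ∧ w 0 ≤ z 0 + t ∧ w 0 + w 1 ≤ z 0 + z 1 + s}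

/-- Membership in a clipped block of radius `R`. [folklore] -/
@[simp] theorem mem_blkR {R : ℕ} {z : Site 2} {t s : ℕ} {w : Site 2} :
    w ∈ blkR R z t s ↔ w ∈ hexBall z R ∧ w 0 ≤ z 0 + t ∧ w 0 + w 1 ≤ z 0 + z 1 + s := Iff.rfl

/-- For `R = 3` the block is `blk`. [folklore] -/
theorem blkR_three (z : Site 2) (t s : ℕ) : blkR 3 z t s = blk z t s := rfl

/-- The two half-planes of the window near the block of `z` (in block parameters): `w₀ ≤ z₀ + t` and `w₀ + w₁ ≤ z₀ + z₁ + s` — where the vertices of `γ_min`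
(which lies over `B_{3n} ⊆ {ξ ≤ 6m} ∩ {σ ≤ 6m}`) can be, `t = t_D = 6m − ξ(z)`, `s = s_R = 6m − σ(z)`. [folklore] -/
def HexShadow.InWin (z : Site 2) (t s : ℕ) (q : Site 2) : Prop := q 0 ≤ z 0 + t ∧ q 0 + q 1 ≤ z 0 + z 1 + s

/-- **The terminal data the generic routing hands to the instance** (everything «HexShadowVRouting» can certify about the first/last visits `E₁, E₂` of
`γ_min(ω)` to the cleared vertex set `W` and the exit `w'` of the `(P2)`-witness): `E₁ ≠ E₂` in `W` over the rerouting block `blk z t_R s_R`, not over `z`; `w' ∈ W` over a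
column different from `z` and from the columns of `E₁, E₂`; and neighbours `o₁ → E₁ → a₁`, `a₂ → E₂ → o₂` along `γ_min` — `o₁, o₂ ∉ W` (the vertices just
before the first / just after the last visit), all four over the window half-planes, pairwise distinct as vertices of a self-avoiding path (`a₁ = a₂` only
when it is the vertex over `z`), `a₁ ≠ E₂`, `a₂ ≠ E₁`, and all four columns different from that of `w'` (which is off the columns of `γ_min`).
[cite: DuminilCopinSidoraviciusTassion2016, §2.3 (proof of Fact 2: u', v', w')] -/
structure HexShadow.Terminals {V : Type} {G : SimpleGraph V} (Φ : HexShadow G) (R : ℕ) (z : Site 2) (tR tD sR : ℕ) (W : Set V) (E₁ E₂ w' : V) : Prop where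
  ne : E₁ ≠ E₂
  E₁W : E₁ ∈ W
  E₂W : E₂ ∈ W
  E₁R : Φ.sh E₁ ∈ blkR R z tR sR
  E₂R : Φ.sh E₂ ∈ blkR R z tR sR
  E₁z : Φ.sh E₁ ≠ z
  E₂z : Φ.sh E₂ ≠ z
  w'W : w' ∈ W
  w'z : Φ.sh w' ≠ z
  w'E₁ : Φ.sh w' ≠ Φ.sh E₁
  w'E₂ : Φ.sh w' ≠ Φ.sh E₂
  nbrs : ∃ o₁ a₁ a₂ o₂ : V, G.Adj o₁ E₁ ∧ G.Adj E₁ a₁ ∧ G.Adj a₂ E₂ ∧ G.Adj E₂ o₂ ∧ o₁ ∉ W ∧ o₂ ∉ W ∧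
    HexShadow.InWin z tD sR (Φ.sh o₁) ∧ HexShadow.InWin z tD sR (Φ.sh a₁) ∧ HexShadow.InWin z tD sR (Φ.sh a₂) ∧ HexShadow.InWin z tD sR (Φ.sh o₂) ∧
    a₁ ≠ o₁ ∧ a₁ ≠ E₂ ∧ a₂ ≠ o₂ ∧ a₂ ≠ E₁ ∧ o₁ ≠ o₂ ∧ o₁ ≠ a₂ ∧ a₁ ≠ o₂ ∧ (a₁ = a₂ → Φ.sh a₁ = z) ∧
    Φ.sh w' ≠ Φ.sh o₁ ∧ Φ.sh w' ≠ Φ.sh a₁ ∧ Φ.sh w' ≠ Φ.sh a₂ ∧ Φ.sh w' ≠ Φ.sh o₂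

/-- **NODE (instance obligation) — SHAPED LOCAL LINKAGE with surgery radius `R`.**  For every block pair `blkR R z t_R s_R ⊆ blkR R z t_D s_D` clipped in
at most one direction the instance chooses a cleared VERTEX set `W` — containing every vertex over `hexBall z 1 ∩ blkR R z t_D s_D` and contained in the
lift of `blkR R z t_D s_D` (so it may drop the block's degenerate vertices) — such that every terminal triple certified by `Terminals` admits a SWAP PAIR of
routings (rerouted piece inside `W ∩ \overline{blkR R z t_R s_R}`, branch inside `W`; the successor of the attachment vertex and the first branch vertex
exchanged).  DST's "three disjoint paths in `\overline{B_R(z)} ∖ {z}`" in the form the vertex-set surgery consumes; an internal obligation on the instance,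
never asserted (aimed at the `(111)`-films `F_k`, `k ≥ 4`, where `LocalLinkage` fails; the generic routing «HexShadowVRouting» consumes `R = 3`). [cite: DuminilCopinSidoraviciusTassion2016, §2.3 (proof of Fact 2, p. 6: the choice of R)] [cite: NewmanTassionWu2017, §3.2 (Def. 3.7)] -/
def HexShadow.ShapedLinkage {V : Type} {G : SimpleGraph V} (Φ : HexShadow G) (R : ℕ) : Prop :=
  ∀ (z : Site 2) (tR tD sR sD : ℕ), tR ≤ tD → sR ≤ sD → (R ≤ tR ∨ R ≤ sR) →
    ∃ W : Set V, (∀ x ∈ W, Φ.sh x ∈ blkR R z tD sD) ∧ (∀ x, Φ.sh x ∈ hexBall z 1 → Φ.sh x ∈ blkR R z tD sD → x ∈ W) ∧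
      ∀ (E₁ E₂ w' : V), Φ.Terminals R z tR tD sR W E₁ E₂ w' →
        ∃ r₁ r₂ : VRouteData G (W ∩ Φ.lift (blkR R z tR sR)) W E₁ E₂ w', r₁.y = r₂.b ∧ r₁.b = r₂.y

/-! ## §3 The keyed routing from a swap pair -/

namespace HexShadow

variable {V : Type} {G : SimpleGraph V} (Φ : HexShadow G)

/-- **The cleared set and the keyed routing under `ShapedLinkage`.** [cite: DuminilCopinSidoraviciusTassion2016, §2.3, proof of Fact 2] -/
theorem exists_W_of_shapedLinkage [Countable V] {R : ℕ} (hL : Φ.ShapedLinkage R) (z : Site 2) {tR tD sR sD : ℕ} (htRD : tR ≤ tD) (hsRD : sR ≤ sD)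
    (hone : R ≤ tR ∨ R ≤ sR) :
    ∃ W : Set V, (∀ x ∈ W, Φ.sh x ∈ blkR R z tD sD) ∧ (∀ x, Φ.sh x ∈ hexBall z 1 → Φ.sh x ∈ blkR R z tD sD → x ∈ W) ∧
      ∀ (E₁ E₂ w' : V), Φ.Terminals R z tR tD sR W E₁ E₂ w' →
        ∃ r : VRouteData G (W ∩ Φ.lift (blkR R z tR sR)) W E₁ E₂ w', vtxKey V r.y < vtxKey V r.b := by
  obtain ⟨W, hW1, hW2, hW3⟩ := hL z tR tD sR sD htRD hsRD hone
  refine ⟨W, hW1, hW2, fun E₁ E₂ w' hT => ?_⟩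
  obtain ⟨r₁, r₂, hy, hb⟩ := hW3 E₁ E₂ w' hT
  exact VRouteData.exists_key r₁ r₂ hy hb

end HexShadow

end Summit.CriticalPhenomena.PercolationContinuityZ3.Theorems.Transplant

end
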